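import Literature.MathematicalPhysics.KineticTheory.FluctuationAbelPositivity

/-!
# Crux `DrudeDissolution` (stmt-AtomisticToContinuum-12593): the VARIATIONAL FLOOR of the Abel functional
# (Mazur's inequality at finite Abel parameter)

Support lemmas for the crux `Summit.AtomisticToContinuum.FouriersLaw.Theses.EmbeddedDrudeMourre.DrudeDissolution`
(lead c14), complementing `Literature/MathematicalPhysics/KineticTheory/FluctuationAbelPositivity.lean`
(`∫₀^∞ e^{-νt} Re⟪ψ, U(t)ψ⟫ dt = ν‖R(ν)ψ‖²`, `R(ν) = (ν − A)⁻¹`, and its positivity).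

For a strongly continuous one-parameter unitary group `U(t) = e^{tA}` on a Hilbert space (`A` skew-symmetric),
`ν > 0`, any vector `ψ` and any TRIAL VECTOR `φ ∈ D(A)`:

  `ν · |⟪ψ, φ⟫|² ≤ (∫₀^∞ e^{-νt} Re⟪ψ, U(t)ψ⟫ dt) · (ν²‖φ‖² + ‖Aφ‖²)`

(`abelVariationalFloor_unitary`): since `ψ = (ν − A)R(ν)ψ` and `A` is skew, `⟪ψ, φ⟫ = ⟪R(ν)ψ, νφ + Aφ⟫`,
`‖νφ + Aφ‖² = ν²‖φ‖² + ‖Aφ‖²`, and Cauchy–Schwarz. It is the Rayleigh–Ritz lower bound for the positive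
operator `(ν − A)*(ν − A) = ν² − A²`, i.e. the quantitative form of Mazur's inequality at finite Abel
parameter: for an exactly conserved `φ` (`Aφ = 0`) it reads `ν ∫₀^∞ e^{-νt} Re⟪ψ, U(t)ψ⟫ dt ≥ |⟪ψ, φ⟫|²/‖φ‖²`
(`→` Mazur's bound on the Drude weight as `ν ↓ 0`), and for an APPROXIMATELY conserved `φ`
(`‖Aφ‖` small) it converts the defect `‖Aφ‖` into a floor of the Abel-regularised Green–Kubo integral.

* §1 complex Hilbert space, `U : OneParameterUnitaryGroup H` (`abelVariationalFloor_unitary`);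
* §2 the real fluctuation space of a strongly continuous `FluctuationDynamics` (`abelVariationalFloor_koopman`,
  trial vector given by a derivative `HasDerivAt (t ↦ U_t φ) η 0`; `abelVariationalFloor_of_conserved`);
* §3 the chain: `ν ⟪[J], φ⟫₀² ≤ (∫₀^∞ e^{-νt} C_μ(t) dt)(ν²‖φ‖₀² + ‖η‖₀²)` for Doyon data `Z`
  (`ZeroWavenumberData.abelVariationalFloor_currentCorrelation`, `…_of_hasMomentumReversal`,
  `…_of_conserved`).

Use on the crux (recorded in `Cruxes/DrudeDissolution/PICKED.md` of lead c14 and the three `Lines/*-dead*.md`):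
with the harmonic-current trial vector this certifies only an `O(νT²)` floor of `∫₀^∞ e^{-νT²t} C_T(t) dt` —
the reason no variational shortcut reaches the T-uniform floors of the lines' engine stubs.

Sorry-free; axioms `propext`, `Classical.choice`, `Quot.sound`.
-/

noncomputable section

open MeasureTheory Filter Set Function
open scoped InnerProductSpace Topology NNReal

namespace Summit.AtomisticToContinuum.FouriersLaw.Theorems.DrudeDissolution

/-! ## §1. Unitary groups on a complex Hilbert space -/

section UnitaryGroup

open Literature.Analysis.UnboundedOperators Literature.MathematicalPhysics.KineticTheory

variable {H : Type*} [NormedAddCommGroup H] [InnerProductSpace ℂ H] [CompleteSpace H]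

/-- **`‖νφ + Aφ‖² = ν²‖φ‖² + ‖Aφ‖²`** for `φ` in the domain of the (skew-symmetric) generator `A` of a
one-parameter unitary group and real `ν ≥ 0` (the cross term `2ν Re⟪φ, Aφ⟫` vanishes). [folklore] -/
theorem norm_smul_add_generator_sq (U : OneParameterUnitaryGroup H) {ν : ℝ} (hν : 0 ≤ ν)
    (φ : (OneParameterGroup.generator U.toStrongContRepresentation).domain) :
    ‖(ν : ℂ) • (φ : H) + (OneParameterGroup.generator U.toStrongContRepresentation φ : H)‖ ^ 2 =
      ν ^ 2 * ‖(φ : H)‖ ^ 2 + ‖(OneParameterGroup.generator U.toStrongContRepresentation φ : H)‖ ^ 2 := by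
  have hre : (⟪(OneParameterGroup.generator U.toStrongContRepresentation φ : H), (φ : H)⟫_ℂ).re = 0 :=
    U.re_inner_generator_self φ
  have hsymm : ⟪(φ : H), (OneParameterGroup.generator U.toStrongContRepresentation φ : H)⟫_ℂ =
      starRingEnd ℂ ⟪(OneParameterGroup.generator U.toStrongContRepresentation φ : H), (φ : H)⟫_ℂ :=
    (inner_conj_symm _ _).symm
  have hre' : RCLike.re ⟪(ν : ℂ) • (φ : H),
      (OneParameterGroup.generator U.toStrongContRepresentation φ : H)⟫_ℂ = 0 := by
    rw [inner_smul_left, Complex.conj_ofReal, RCLike.re_to_complex, Complex.re_ofReal_mul, hsymm,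
      Complex.conj_re, hre, mul_zero]
  rw [norm_add_sq (𝕜 := ℂ), hre', mul_zero, add_zero, norm_smul, Complex.norm_real, Real.norm_eq_abs,
    abs_of_nonneg hν, mul_pow]

/-- **Variational floor of the Abel functional (Mazur's inequality at finite Abel parameter).** For a
strongly continuous one-parameter unitary group `U(t) = e^{tA}`, `ν > 0`, any `ψ` and any trial vector
`φ ∈ D(A)`:
`ν |⟪ψ, φ⟫|² ≤ (∫₀^∞ e^{-νt} Re⟪ψ, U(t)ψ⟫ dt) (ν²‖φ‖² + ‖Aφ‖²)`.
Proof: the Abel functional is `ν‖R‖²` with `R = R(ν)ψ ∈ D(A)`, `AR = νR − ψ`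
(`UnitaryRep.integral_exp_neg_mul_re_inner_appReal`); so `⟪ψ, φ⟫ = ⟪νR − AR, φ⟫ = ⟪R, νφ + Aφ⟫` by
skew-symmetry (`UnitaryRep.inner_generator_eq_neg`), and Cauchy–Schwarz with
`‖νφ + Aφ‖² = ν²‖φ‖² + ‖Aφ‖²`. [folklore] -/
theorem abelVariationalFloor_unitary (U : OneParameterUnitaryGroup H) {ν : ℝ} (hν : 0 < ν) (ψ : H)
    (φ : (OneParameterGroup.generator U.toStrongContRepresentation).domain) :
    ν * ‖⟪ψ, (φ : H)⟫_ℂ‖ ^ 2 ≤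
      (∫ t in Ioi (0 : ℝ), Real.exp (-(ν * t)) * (⟪ψ, U.appReal t ψ⟫_ℂ).re) *
        (ν ^ 2 * ‖(φ : H)‖ ^ 2 +
          ‖(OneParameterGroup.generator U.toStrongContRepresentation φ : H)‖ ^ 2) := by
  set T := OneParameterGroup.toC0Semigroup U.toStrongContRepresentation with hT
  have hM := U.norm_toC0Semigroup_app_le
  have hl : (0 : ℝ) < ((ν : ℂ)).re := by simpa using hν
  set R : H := T.laplaceResolventFun (ν : ℂ) ψ with hR
  have hReq : R = ∫ t in Ioi (0 : ℝ), Complex.exp (-((ν : ℂ) * t)) • U.appReal t ψ :=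
    U.laplaceResolventFun_toC0Semigroup_eq (ν : ℂ) ψ
  -- the Abel functional is `ν ‖R‖²`
  have habel : ∫ t in Ioi (0 : ℝ), Real.exp (-(ν * t)) * (⟪ψ, U.appReal t ψ⟫_ℂ).re = ν * ‖R‖ ^ 2 := by
    rw [U.integral_exp_neg_mul_re_inner_appReal hν ψ, ← hReq]
  -- `R ∈ D(A)` and `A R = νR − ψ`
  have hRdom : R ∈ (OneParameterGroup.generator U.toStrongContRepresentation).domain :=
    C0Semigroup.laplaceResolventFun_mem_generator_domain T hM hl ψ
  have hgen : (OneParameterGroup.generator U.toStrongContRepresentation ⟨R, hRdom⟩ : H) =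
      (ν : ℂ) • R - ψ :=
    C0Semigroup.generator_laplaceResolventFun T hM hl ψ
  have hψ : ψ = (ν : ℂ) • R - OneParameterGroup.generator U.toStrongContRepresentation ⟨R, hRdom⟩ := by
    rw [hgen]; abel
  -- `⟪ψ, φ⟫ = ⟪R, νφ + Aφ⟫`
  have hinner : ⟪ψ, (φ : H)⟫_ℂ =
      ⟪R, (ν : ℂ) • (φ : H) + (OneParameterGroup.generator U.toStrongContRepresentation φ : H)⟫_ℂ := by
    have hskew := U.inner_generator_eq_neg ⟨R, hRdom⟩ φ
    conv_lhs => rw [hψ]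
    rw [inner_sub_left, inner_smul_left, Complex.conj_ofReal, inner_add_right, inner_smul_right, hskew]
    ring
  -- Cauchy–Schwarz
  have hCS : ‖⟪ψ, (φ : H)⟫_ℂ‖ ≤
      ‖R‖ * ‖(ν : ℂ) • (φ : H) + (OneParameterGroup.generator U.toStrongContRepresentation φ : H)‖ := by
    rw [hinner]; exact norm_inner_le_norm _ _
  have h2 : ‖⟪ψ, (φ : H)⟫_ℂ‖ ^ 2 ≤ ‖R‖ ^ 2 * (ν ^ 2 * ‖(φ : H)‖ ^ 2 +
      ‖(OneParameterGroup.generator U.toStrongContRepresentation φ : H)‖ ^ 2) := by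
    rw [← norm_smul_add_generator_sq U hν.le φ, ← mul_pow]
    exact pow_le_pow_left₀ (norm_nonneg _) hCS 2
  rw [habel]
  calc ν * ‖⟪ψ, (φ : H)⟫_ℂ‖ ^ 2
      ≤ ν * (‖R‖ ^ 2 * (ν ^ 2 * ‖(φ : H)‖ ^ 2 +
          ‖(OneParameterGroup.generator U.toStrongContRepresentation φ : H)‖ ^ 2)) :=
        mul_le_mul_of_nonneg_left h2 hν.le
    _ = ν * ‖R‖ ^ 2 * (ν ^ 2 * ‖(φ : H)‖ ^ 2 +
          ‖(OneParameterGroup.generator U.toStrongContRepresentation φ : H)‖ ^ 2) := by ring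

/-- **Mazur's inequality at finite Abel parameter (unitary group).** For an INVARIANT vector `φ`
(`U(t)φ = φ` for all `t`) and `ν > 0`: `|⟪ψ, φ⟫|² ≤ ν (∫₀^∞ e^{-νt} Re⟪ψ, U(t)ψ⟫ dt) ‖φ‖²`
(the case `Aφ = 0` of `abelVariationalFloor_unitary`; as `ν ↓ 0` the left factor tends to the Drude
weight `σ_ψ{0}`, giving Mazur's bound `σ_ψ{0} ≥ |⟪ψ, φ⟫|²/‖φ‖²`). [folklore] -/
theorem abelVariationalFloor_unitary_of_invariant (U : OneParameterUnitaryGroup H) {ν : ℝ} (hν : 0 < ν)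
    (ψ : H) {φ : H} (hφ : ∀ t : ℝ, U.appReal t φ = φ) :
    ‖⟪ψ, φ⟫_ℂ‖ ^ 2 ≤
      ν * (∫ t in Ioi (0 : ℝ), Real.exp (-(ν * t)) * (⟪ψ, U.appReal t ψ⟫_ℂ).re) * ‖φ‖ ^ 2 := by
  -- `φ ∈ D(A)` with `Aφ = 0`: the orbit is constant
  have hd : HasDerivAt (fun t : ℝ => OneParameterGroup.app U.toStrongContRepresentation t φ) (0 : H) 0 := by
    have hc : (fun t : ℝ => OneParameterGroup.app U.toStrongContRepresentation t φ) = fun _ => φ := by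
      funext t
      rw [UnitaryRep.app_toStrongContRepresentation, hφ t]
    rw [hc]
    exact hasDerivAt_const 0 φ
  obtain ⟨hx, hval⟩ := OneParameterGroup.mem_generator_domain_of_hasDerivAt U.toStrongContRepresentation hd
  have key := abelVariationalFloor_unitary U hν ψ ⟨φ, hx⟩
  rw [hval, norm_zero, zero_pow two_ne_zero, add_zero] at key
  -- key : ν * ‖⟪ψ, φ⟫‖² ≤ A * (ν² ‖φ‖²)
  have hA := U.integral_exp_neg_mul_re_inner_appReal_nonneg hν ψ
  nlinarith [hA, sq_nonneg ‖φ‖, norm_nonneg ⟪ψ, φ⟫_ℂ, sq_nonneg ‖⟪ψ, φ⟫_ℂ‖]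

end UnitaryGroup

/-! ## §2. The orthogonal Koopman group of a strongly continuous fluctuation dynamics -/

section Fluctuation

open Literature.Analysis.UnboundedOperators Literature.MathematicalPhysics.KineticTheory

variable {G Ω : Type*} [AddCommGroup G] [MeasurableSpace G] [MeasurableSpace Ω]
  {ν₀ : Measure G} {T : ShiftAction G Ω} {D : FluctuationDynamics ν₀ T}
  [MeasurableNeg G] [ν₀.IsNegInvariant]

/-- **Variational floor of the Abel functional of an autocorrelation (real fluctuation space).** For a
strongly continuous fluctuation dynamics with Koopman group `U_t`, `ν > 0`, any `ψ` and any trial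
vector `φ` whose orbit is differentiable at `0` with derivative `η = Lφ`:
`ν ⟪ψ, φ⟫² ≤ (∫₀^∞ e^{-νt} ⟪ψ, U_t ψ⟫ dt) (ν²‖φ‖² + ‖η‖²)` — by complexification from
`abelVariationalFloor_unitary`. [folklore] -/
theorem abelVariationalFloor_koopman (h : D.IsStronglyContinuous) {ν : ℝ} (hν : 0 < ν)
    (ψ : D.FluctuationSpace) {φ η : D.FluctuationSpace}
    (hφ : HasDerivAt (fun t : ℝ => D.koopman t φ) η 0) :
    ν * ⟪ψ, φ⟫_ℝ ^ 2 ≤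
      (∫ t in Ioi (0 : ℝ), Real.exp (-(ν * t)) * ⟪ψ, D.koopman t ψ⟫_ℝ) * (ν ^ 2 * ‖φ‖ ^ 2 + ‖η‖ ^ 2) := by
  simp only [FluctuationDynamics.koopman_apply] at hφ ⊢
  -- the complexified group `U(t) = (U_t)_ℂ` (this is `D.unitaryGroup h`, kept in explicit form)
  have hd : HasDerivAt (fun t : ℝ => OneParameterGroup.app
      (Complexification.unitaryGroupOfReal D.koopmanCLM D.koopmanCLM_zero D.koopmanCLM_add
        D.norm_koopmanCLM h).toStrongContRepresentation t (Complexification.ofReal φ))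
      (Complexification.ofReal η) 0 := by
    simp only [UnitaryRep.app_toStrongContRepresentation]
    exact Complexification.hasDerivAt_unitaryGroupOfReal_ofReal (h0 := D.koopmanCLM_zero)
      (hadd := D.koopmanCLM_add) (hnorm := D.norm_koopmanCLM) (hcont := h) hφ
  obtain ⟨hx, hval⟩ := OneParameterGroup.mem_generator_domain_of_hasDerivAt _ hd
  have key := abelVariationalFloor_unitary
    (Complexification.unitaryGroupOfReal D.koopmanCLM D.koopmanCLM_zero D.koopmanCLM_add
      D.norm_koopmanCLM h) hν (Complexification.ofReal ψ) ⟨Complexification.ofReal φ, hx⟩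
  rw [hval] at key
  simp only [Complexification.unitaryGroupOfReal_appReal_ofReal, Complexification.inner_ofReal_ofReal,
    Complex.ofReal_re, Complex.norm_real, Real.norm_eq_abs, sq_abs, LinearIsometry.norm_map] at key
  exact key

/-- **Mazur's inequality at finite Abel parameter (real fluctuation space).** For a conserved charge
`φ ∈ 𝒬₀` (`U_t φ = φ` for all `t`) and `ν > 0`:
`⟪ψ, φ⟫² ≤ ν (∫₀^∞ e^{-νt} ⟪ψ, U_t ψ⟫ dt) ‖φ‖²`. [folklore] -/
theorem abelVariationalFloor_of_conserved (h : D.IsStronglyContinuous) {ν : ℝ} (hν : 0 < ν)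
    (ψ : D.FluctuationSpace) {φ : D.FluctuationSpace} (hφ : φ ∈ D.conservedSpace) :
    ⟪ψ, φ⟫_ℝ ^ 2 ≤ ν * (∫ t in Ioi (0 : ℝ), Real.exp (-(ν * t)) * ⟪ψ, D.koopman t ψ⟫_ℝ) * ‖φ‖ ^ 2 := by
  have hconst : HasDerivAt (fun t : ℝ => D.koopman t φ) (0 : D.FluctuationSpace) 0 := by
    have hc : (fun t : ℝ => D.koopman t φ) = fun _ => φ := by
      funext t
      exact (D.mem_conservedSpace_iff.1 hφ) t
    rw [hc]
    exact hasDerivAt_const 0 φ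
  have key := abelVariationalFloor_koopman h hν ψ hconst
  rw [norm_zero, zero_pow two_ne_zero, add_zero] at key
  have hA := h.integral_exp_neg_mul_inner_koopman_nonneg hν ψ
  nlinarith [hA, sq_nonneg ‖φ‖, sq_nonneg ⟪ψ, φ⟫_ℝ]

end Fluctuation

/-! ## §3. The chain: floors for `∫₀^∞ e^{-νt} C_μ(t) dt` on Doyon's `ℋ₀(μ)` -/

section Chain

open Literature.MathematicalPhysics.KineticTheory Literature.MathematicalPhysics.KineticTheory.HeatConduction

variable {P : OscillatorChain} {D : InfiniteChainDynamics P} (Z : ZeroWavenumberData P D)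

/-- **Variational floor of the chain's Abel-regularised Green–Kubo integral.** If the Koopman group on
`ℋ₀(μ)` is strongly continuous and the mean current vanishes, then for `ν > 0` and every trial vector
`φ ∈ ℋ₀` with `d/dt|₀ U_t φ = η`:
`ν ⟪[J], φ⟫₀² ≤ (∫₀^∞ e^{-νt} C_μ(t) dt) (ν²‖φ‖₀² + ‖η‖₀²)`.
(An approximately conserved `φ` overlapping the current gives a floor
`∫₀^∞ e^{-νt} C_μ ≥ ν⟪[J],φ⟫₀²/(ν²‖φ‖₀² + ‖Lφ‖₀²)`.) [folklore] -/
theorem _root_.Literature.MathematicalPhysics.KineticTheory.HeatConduction.ZeroWavenumberData.abelVariationalFloor_currentCorrelation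
    (hU : Z.toFluctuationDynamics.IsStronglyContinuous)
    (hmean : ∫ σ, P.bondCurrentZ σ 0 ∂Z.μ = 0) {ν : ℝ} (hν : 0 < ν)
    {φ η : ZeroWavenumberSpace Z} (hφ : HasDerivAt (fun t : ℝ => Z.koopman t φ) η 0) :
    ν * ⟪Z.currentClass, φ⟫_ℝ ^ 2 ≤
      (∫ t in Ioi (0 : ℝ), Real.exp (-(ν * t)) * D.currentCorrelation Z.μ t) *
        (ν ^ 2 * ‖φ‖ ^ 2 + ‖η‖ ^ 2) := by
  simp_rw [← Z.inner_currentClass_koopman_eq_currentCorrelation hmean]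
  exact abelVariationalFloor_koopman hU hν Z.currentClass hφ

/-- The momentum-reversal-symmetric form (`⟨j_0⟩_μ = 0` automatic):
`ν ⟪[J], φ⟫₀² ≤ (∫₀^∞ e^{-νt} C_μ(t) dt)(ν²‖φ‖₀² + ‖η‖₀²)`. [folklore] -/
theorem _root_.Literature.MathematicalPhysics.KineticTheory.HeatConduction.ZeroWavenumberData.abelVariationalFloor_currentCorrelation_of_hasMomentumReversal
    (hR : Z.HasMomentumReversal) (hU : Z.toFluctuationDynamics.IsStronglyContinuous) {ν : ℝ} (hν : 0 < ν)
    {φ η : ZeroWavenumberSpace Z} (hφ : HasDerivAt (fun t : ℝ => Z.koopman t φ) η 0) :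
    ν * ⟪Z.currentClass, φ⟫_ℝ ^ 2 ≤
      (∫ t in Ioi (0 : ℝ), Real.exp (-(ν * t)) * D.currentCorrelation Z.μ t) *
        (ν ^ 2 * ‖φ‖ ^ 2 + ‖η‖ ^ 2) :=
  Z.abelVariationalFloor_currentCorrelation hU (Z.integral_bondCurrent_eq_zero hR) hν hφ

/-- **Mazur's inequality at finite Abel parameter for the chain.** For a conserved charge `φ ∈ 𝒬₀` of
`ℋ₀(μ)` (strong continuity, zero mean current) and `ν > 0`:
`⟪[J], φ⟫₀² ≤ ν (∫₀^∞ e^{-νt} C_μ(t) dt) ‖φ‖₀²` — a conserved charge overlapping the current keeps the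
Abel-regularised Green–Kubo integral above `⟪[J],φ⟫₀²/(ν‖φ‖₀²)`, the Drude floor. [folklore] -/
theorem _root_.Literature.MathematicalPhysics.KineticTheory.HeatConduction.ZeroWavenumberData.abelVariationalFloor_currentCorrelation_of_conserved
    (hU : Z.toFluctuationDynamics.IsStronglyContinuous)
    (hmean : ∫ σ, P.bondCurrentZ σ 0 ∂Z.μ = 0) {ν : ℝ} (hν : 0 < ν)
    {φ : ZeroWavenumberSpace Z} (hφ : φ ∈ Z.toFluctuationDynamics.conservedSpace) :
    ⟪Z.currentClass, φ⟫_ℝ ^ 2 ≤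
      ν * (∫ t in Ioi (0 : ℝ), Real.exp (-(ν * t)) * D.currentCorrelation Z.μ t) * ‖φ‖ ^ 2 := by
  simp_rw [← Z.inner_currentClass_koopman_eq_currentCorrelation hmean]
  exact abelVariationalFloor_of_conserved hU hν Z.currentClass hφ

/-- **Registered form (colon header) of the chain's variational Abel floor**: for Doyon data `Z` of an
infinite chain with momentum-reversal symmetry and strongly continuous Koopman group on `ℋ₀(μ)`, every
`ν > 0` and every trial vector `φ` with `d/dt|₀ U_t φ = η`,
`ν ⟪[J], φ⟫₀² ≤ (∫₀^∞ e^{-νt} C_μ(t) dt)(ν²‖φ‖₀² + ‖η‖₀²)`. [folklore] -/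
theorem abelVariationalFloor_chain :
    ∀ {P : OscillatorChain} {D : InfiniteChainDynamics P} (Z : ZeroWavenumberData P D),
      Z.HasMomentumReversal → Z.toFluctuationDynamics.IsStronglyContinuous →
      ∀ (ν : ℝ), 0 < ν → ∀ (φ η : ZeroWavenumberSpace Z), HasDerivAt (fun t : ℝ => Z.koopman t φ) η 0 →
        ν * ⟪Z.currentClass, φ⟫_ℝ ^ 2 ≤
          (∫ t in Set.Ioi (0 : ℝ), Real.exp (-(ν * t)) * D.currentCorrelation Z.μ t) *
            (ν ^ 2 * ‖φ‖ ^ 2 + ‖η‖ ^ 2) :=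
  fun Z hR hU _ν hν _φ _η hφ => Z.abelVariationalFloor_currentCorrelation_of_hasMomentumReversal hR hU hν hφ

end Chain

end Summit.AtomisticToContinuum.FouriersLaw.Theorems.DrudeDissolution

end
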